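import Summits.BirchSwinnertonDyer.BirchSwinnertonDyer.Theorems.Rank2ObservatoryRank3Witness
import HarnessLib

/-!
# BirchSwinnertonDyer — rank ≥ 2 observatory: tangent certificate and addition chains modulo `q`

HONEST FRAMING: per-curve certified theorems and census instruments; no claim on BSD in rank ≥ 2.

Kernel primitives for SCALAR MULTIPLICATION in `Ẽ(𝔽_q)` supplied as DATA, for the next kernel
instrument (saturation of the listed generators at an odd prime `p`: the witness at a good prime
`q` is `k • R̃ ≠ O` with `p · k = #Ẽ(𝔽_q)`, `Rank2ObservatoryListedSpanP.lean`). Nothing is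
computed in the kernel: the engine writes the intermediate points of a double-and-add chain and the
kernel checks each step with a cleared-denominator identity.

* `zmodTangent V q x₁ y₁ x₃ y₃` — the TANGENT certificate modulo `q` (`(x₃, y₃) = 2 • (x₁, y₁)` on
  `V mod q`, `D = 2y₁ + a₁x₁ + a₃ ≠ 0`; the `ZMod q` analogue of `intTangent` of
  `Rank2ObservatoryTangentCert.lean`), soundness `exists_some_add_self_of_zmodTangent`
  (Mathlib's `add_self_of_Y_ne`, `slope_of_Y_ne`);
* `chainB V q xR yR cur steps` — an AFFINE ADDITION CHAIN for multiples of `R = (xR, yR)`: each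
  step `(true, x, y)` doubles the current point (`zmodTangent`), each step `(false, x, y)` adds `R`
  to it (`zmodChord` of `Rank2ObservatoryRank3Witness.lean`), `(x, y)` being the claimed result;
  `chainMult n steps` is the multiplier reached from `n`, `chainLast cur steps` the last point;
* `exists_nsmul_eq_some_of_chainB` — soundness: `chainMult n steps • R` is the affine point
  `chainLast`; `nsmul_ne_zero_of_chainB` — hence `chainMult 1 steps • R ≠ O` (an affine point is
  not `O`): the one inequality the `p`-saturation witness needs.

All steps are affine, so a chain passing through `O` or through `±R` before a chord step is simply
not certifiable — the producer picks another chain or another prime (soundness is all the kernel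
needs). Sorry-free; no `decide` is executed here (the Booleans are for data files).

References: J. H. Silverman, *The Arithmetic of Elliptic Curves* (2nd ed. 2009), III.2.3 (group
law, duplication formula); S. Siksek, Rocky Mountain J. Math. 25 (1995) §3.
-/

-- single-conjunct summit: `Summit.BirchSwinnertonDyer.BirchSwinnertonDyer.…` repeats the name
set_option linter.dupNamespace false

namespace Summit.BirchSwinnertonDyer.BirchSwinnertonDyer.Rank2Observatory

open WeierstrassCurve

/-! ### The tangent certificate modulo `q` -/

section Tangent

/-- TANGENT CERTIFICATE modulo `q`, denominators cleared (a Boolean for `decide`):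
`(x₃, y₃) = 2 • (x₁, y₁)` on `V mod q` with `D = 2y₁ + a₁x₁ + a₃ ≠ 0`,
`n = 3x₁² + 2a₂x₁ + a₄ − a₁y₁`, slope `n/D`: `x₃·D² = n² + a₁·n·D − (a₂ + 2x₁)·D²` and
`y₃·D = −(n·(x₃ − x₁) + y₁·D) − a₁x₃D − a₃D` (Silverman AEC III.2.3; as `intTangent`, but over
`ZMod q`). [cite: SilvermanAEC2009, III.2.3] -/
def zmodTangent (V : WeierstrassCurve ℤ) (q : ℕ) [NeZero q] (x₁ y₁ x₃ y₃ : ZMod q) : Bool :=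
  decide (2 * y₁ + (V.a₁ : ZMod q) * x₁ + (V.a₃ : ZMod q) ≠ 0 ∧
    x₃ * (2 * y₁ + (V.a₁ : ZMod q) * x₁ + (V.a₃ : ZMod q)) ^ 2 =
      (3 * x₁ ^ 2 + 2 * (V.a₂ : ZMod q) * x₁ + (V.a₄ : ZMod q) - (V.a₁ : ZMod q) * y₁) ^ 2
        + (V.a₁ : ZMod q)
          * (3 * x₁ ^ 2 + 2 * (V.a₂ : ZMod q) * x₁ + (V.a₄ : ZMod q) - (V.a₁ : ZMod q) * y₁)
          * (2 * y₁ + (V.a₁ : ZMod q) * x₁ + (V.a₃ : ZMod q))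
        - ((V.a₂ : ZMod q) + 2 * x₁) * (2 * y₁ + (V.a₁ : ZMod q) * x₁ + (V.a₃ : ZMod q)) ^ 2 ∧
    y₃ * (2 * y₁ + (V.a₁ : ZMod q) * x₁ + (V.a₃ : ZMod q)) =
      -((3 * x₁ ^ 2 + 2 * (V.a₂ : ZMod q) * x₁ + (V.a₄ : ZMod q) - (V.a₁ : ZMod q) * y₁)
            * (x₃ - x₁)
          + y₁ * (2 * y₁ + (V.a₁ : ZMod q) * x₁ + (V.a₃ : ZMod q)))
        - (V.a₁ : ZMod q) * x₃ * (2 * y₁ + (V.a₁ : ZMod q) * x₁ + (V.a₃ : ZMod q))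
        - (V.a₃ : ZMod q) * (2 * y₁ + (V.a₁ : ZMod q) * x₁ + (V.a₃ : ZMod q)))

variable (V : WeierstrassCurve ℤ) (q : ℕ) [Fact q.Prime]

/-- Transport of `Point.some` along equal coordinates. [folklore] -/
private theorem some_congr₃ {F : Type*} [CommRing F] {W : Affine F} {x y x' y' : F}
    (hx : x = x') (hy : y = y') (h : W.Nonsingular x y) :
    ∃ h' : W.Nonsingular x' y', Affine.Point.some x y h = .some x' y' h' := by
  subst hx hy
  exact ⟨h, rfl⟩

/-- **Soundness of the tangent certificate modulo `q`**: in `Ẽ(𝔽_q)` the affine point doubles to the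
certified point (Mathlib's `add_self_of_Y_ne`, `slope_of_Y_ne`, clearing `D ≠ 0`).
[cite: SilvermanAEC2009, III.2.3] -/
theorem exists_some_add_self_of_zmodTangent {x₁ y₁ x₃ y₃ : ZMod q}
    (h₁ : (V.map (Int.castRingHom (ZMod q))).toAffine.Nonsingular x₁ y₁)
    (hc : zmodTangent V q x₁ y₁ x₃ y₃ = true) :
    ∃ h₃ : (V.map (Int.castRingHom (ZMod q))).toAffine.Nonsingular x₃ y₃,
      (Affine.Point.some x₁ y₁ h₁ : (V.map (Int.castRingHom (ZMod q))).toAffine.Point) +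
        .some x₁ y₁ h₁ = .some x₃ y₃ h₃ := by
  classical
  simp only [zmodTangent, decide_eq_true_eq] at hc
  obtain ⟨hD, hX, hY⟩ := hc
  have ha₁ : (V.map (Int.castRingHom (ZMod q))).a₁ = (V.a₁ : ZMod q) := by
    simp [WeierstrassCurve.map]
  have ha₂ : (V.map (Int.castRingHom (ZMod q))).a₂ = (V.a₂ : ZMod q) := by
    simp [WeierstrassCurve.map]
  have ha₃ : (V.map (Int.castRingHom (ZMod q))).a₃ = (V.a₃ : ZMod q) := by
    simp [WeierstrassCurve.map]
  have ha₄ : (V.map (Int.castRingHom (ZMod q))).a₄ = (V.a₄ : ZMod q) := by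
    simp [WeierstrassCurve.map]
  have hDval : y₁ - (V.map (Int.castRingHom (ZMod q))).toAffine.negY x₁ y₁ =
      2 * y₁ + (V.a₁ : ZMod q) * x₁ + (V.a₃ : ZMod q) := by
    simp only [Affine.negY, ha₁, ha₃]; ring
  have hy : y₁ ≠ (V.map (Int.castRingHom (ZMod q))).toAffine.negY x₁ y₁ := by
    intro h; apply hD; rw [← hDval]; exact sub_eq_zero.mpr h
  rw [Affine.Point.add_self_of_Y_ne hy]
  set L := (V.map (Int.castRingHom (ZMod q))).toAffine.slope x₁ x₁ y₁ y₁ with hLdef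
  have hLD : L * (2 * y₁ + (V.a₁ : ZMod q) * x₁ + (V.a₃ : ZMod q)) =
      3 * x₁ ^ 2 + 2 * (V.a₂ : ZMod q) * x₁ + (V.a₄ : ZMod q) - (V.a₁ : ZMod q) * y₁ := by
    rw [hLdef, Affine.slope_of_Y_ne rfl hy, hDval, ha₁, ha₂, ha₄]; exact div_mul_cancel₀ _ hD
  have hX3 : (V.map (Int.castRingHom (ZMod q))).toAffine.addX x₁ x₁ L = x₃ := by
    apply mul_right_cancel₀ (pow_ne_zero 2 hD)
    rw [hX, ← hLD]
    simp only [Affine.addX, ha₁, ha₂]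
    ring
  have hY3 : (V.map (Int.castRingHom (ZMod q))).toAffine.addY x₁ x₁ y₁ L = y₃ := by
    apply mul_right_cancel₀ hD
    rw [hY, ← hLD]
    simp only [Affine.addY, Affine.negAddY, Affine.negY, hX3, ha₁, ha₃]
    ring
  exact some_congr₃ hX3 hY3 _

end Tangent

/-! ### Affine addition chains -/

section Chain

variable (V : WeierstrassCurve ℤ) (q : ℕ)

/-- One step of an affine addition chain for multiples of `R = (xR, yR)` from the current point
`cur`: `(true, x, y)` claims `(x, y) = 2 • cur` (tangent certificate), `(false, x, y)` claims
`(x, y) = cur + R` (chord certificate). [cite: SilvermanAEC2009, III.2.3] -/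
def chainStepB [NeZero q] (xR yR : ZMod q) (cur : ZMod q × ZMod q) :
    Bool × ZMod q × ZMod q → Bool
  | (true, x, y) => zmodTangent V q cur.1 cur.2 x y
  | (false, x, y) => zmodChord V q cur.1 cur.2 xR yR x y

/-- The whole chain checks: every step is certified from the point reached before it.
[cite: SilvermanAEC2009, III.2.3] -/
def chainB [NeZero q] (xR yR : ZMod q) : ZMod q × ZMod q → List (Bool × ZMod q × ZMod q) → Bool
  | _, [] => true
  | cur, s :: rest => chainStepB V q xR yR cur s && chainB xR yR s.2 rest

/-- The multiplier reached by a chain started at multiplier `n` (`true`: `n ↦ n + n`,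
`false`: `n ↦ n + 1`). [folklore] -/
def chainMult {α : Type*} : ℕ → List (Bool × α) → ℕ
  | n, [] => n
  | n, (true, _) :: rest => chainMult (n + n) rest
  | n, (false, _) :: rest => chainMult (n + 1) rest

/-- The last point of a chain (the start if the chain is empty). [folklore] -/
def chainLast {α : Type*} : α → List (Bool × α) → α
  | cur, [] => cur
  | _, s :: rest => chainLast s.2 rest

variable [Fact q.Prime]

/-- **Soundness of affine addition chains**: if `n • R` is the affine point `cur` and the chain
checks from `cur`, then `chainMult n steps • R` is the affine point `chainLast cur steps`
(induction on the chain; each step is `add_nsmul` / `succ_nsmul` plus the tangent / chord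
certificate). [cite: SilvermanAEC2009, III.2.3] -/
theorem exists_nsmul_eq_some_of_chainB {xR yR : ZMod q}
    (hR : (V.map (Int.castRingHom (ZMod q))).toAffine.Nonsingular xR yR) :
    ∀ (steps : List (Bool × ZMod q × ZMod q)) (cur : ZMod q × ZMod q) (n : ℕ)
      (hcur : (V.map (Int.castRingHom (ZMod q))).toAffine.Nonsingular cur.1 cur.2),
      n • (Affine.Point.some xR yR hR : (V.map (Int.castRingHom (ZMod q))).toAffine.Point) =
          .some cur.1 cur.2 hcur →
        chainB V q xR yR cur steps = true →
        ∃ h : (V.map (Int.castRingHom (ZMod q))).toAffine.Nonsingular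
            (chainLast cur steps).1 (chainLast cur steps).2,
          chainMult n steps •
              (Affine.Point.some xR yR hR : (V.map (Int.castRingHom (ZMod q))).toAffine.Point) =
            .some (chainLast cur steps).1 (chainLast cur steps).2 h := by
  intro steps
  induction steps with
  | nil =>
    intro cur n hcur hn _
    exact ⟨hcur, hn⟩
  | cons s rest ih =>
    intro cur n hcur hn hc
    obtain ⟨b, x, y⟩ := s
    have hc' : chainStepB V q xR yR cur (b, x, y) = true ∧ chainB V q xR yR (x, y) rest = true := by
      simpa [chainB, Bool.and_eq_true] using hc
    obtain ⟨hs, hrest⟩ := hc'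
    cases b with
    | true =>
      obtain ⟨h₃, hadd⟩ := exists_some_add_self_of_zmodTangent V q hcur hs
      have hn' : (n + n) •
          (Affine.Point.some xR yR hR : (V.map (Int.castRingHom (ZMod q))).toAffine.Point) =
            .some x y h₃ := by
        rw [add_nsmul, hn, hadd]
      exact ih (x, y) (n + n) h₃ hn' hrest
    | false =>
      obtain ⟨h₃, hadd⟩ := exists_some_add_some_of_zmodChord V q hcur hR hs
      have hn' : (n + 1) •
          (Affine.Point.some xR yR hR : (V.map (Int.castRingHom (ZMod q))).toAffine.Point) =
            .some x y h₃ := by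
        rw [succ_nsmul, hn, hadd]
      exact ih (x, y) (n + 1) h₃ hn' hrest

/-- **The scalar-multiple witness**: a checked chain from `R` itself exhibits
`chainMult 1 steps • R` as an affine point, so `chainMult 1 steps • R ≠ O` in `Ẽ(𝔽_q)`.
[cite: SilvermanAEC2009, III.2.3] -/
theorem nsmul_ne_zero_of_chainB {xR yR : ZMod q}
    (hR : (V.map (Int.castRingHom (ZMod q))).toAffine.Nonsingular xR yR)
    {steps : List (Bool × ZMod q × ZMod q)} (hc : chainB V q xR yR (xR, yR) steps = true) :
    chainMult 1 steps •
        (Affine.Point.some xR yR hR : (V.map (Int.castRingHom (ZMod q))).toAffine.Point) ≠ 0 := by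
  obtain ⟨h, e⟩ := exists_nsmul_eq_some_of_chainB V q hR steps (xR, yR) 1 hR (one_nsmul _) hc
  rw [e]
  exact Affine.Point.some_ne_zero h

end Chain

end Summit.BirchSwinnertonDyer.BirchSwinnertonDyer.Rank2Observatory
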